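import Summits.Schanuel.Schanuel.Theorems.ZilberEacLogTranscendence
import Summits.Schanuel.Schanuel.Theorems.ZilberEacGrowthDensity
import Mathlib.Analysis.Normed.Field.Lemmas
import HarnessLib

/-!
# The equimodular class, IV: THEOREM T — Zariski density from an exact transcendental relation
# (no growth)

HONEST FRAMING.  Cell `pub-schanuel` (Zilber's Exponential-Algebraic Closedness, case ladder;
host summit Schanuel), seat 2, gen 22.  THEOREM G (`unprojectedDense_of_growth`, gen 3) decides
density by the ESCAPE of one additive coordinate.  On the totally degenerate members of the
equimodular class no coordinate escapes (`|y₁| → const`).  THEOREM T replaces growth by an EXACT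
relation: **`unprojectedDense_of_transcendental_relation`** — let `S` be irreducible closed of
dimension `≤ 2`, `p_m ∈ S ∩ Γ_exp` with `‖x_{j₀}(p_m)‖ → ∞` and `y_{j₁}(p_m) = w(1/x_{j₀}(p_m))` for a
function `w` analytic at `0` that is TRANSCENDENTAL over `ℂ(z)` at `0` (no nonzero `H ∈ ℂ[s][t]` has
`H(1/u, w(u)) = 0` for all small `u ≠ 0`); then the exponential points of `S` are Zariski dense.
Proof: as for THEOREM G, an `f ∉ I(S)` vanishing at infinitely many `p_m` yields a prime `J ⊋ I(S)`
with `dim ≤ 1`, `x_{j₀}` transcendental mod `J`, hence a nonzero relation `H(x_{j₀}, y_{j₁}) = 0` on an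
infinite subsequence; so `u ↦ u^N H(1/u, w(u))` (analytic at `0`) has zeros accumulating at `0`, hence
vanishes near `0` (identity principle) — contradicting transcendence.  [folklore]; nothing here is
specific to Schanuel's conjecture (neither used nor implied); Mantova–Masser's question stays OPEN.
-/

noncomputable section

open Filter Topology Polynomial MvPolynomial Bornology
open Literature.NumberTheory.Transcendental Literature.ModelTheory.Zilber
open Literature.ModelTheory.ExponentialFields

set_option linter.dupNamespace false

namespace Summit.Schanuel.Schanuel.Theorems

variable {n : ℕ}

/-! ## Part A. Evaluation of a relation between two arbitrary coordinates -/

/-- **Evaluation step (two arbitrary coordinates).**  A relation `H(u, v) = 0` between the classes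
of `X i, X j` modulo `I({p m : m ∈ M})` specialises to `H((p m) i, (p m) j) = 0` for `m ∈ M`.
[folklore] -/
theorem polyPoly_eval_eq_zero_of_mem₂ {p : ℕ → Fin n ⊕ Fin n → ℂ} {M : Set ℕ} (i j : Fin n ⊕ Fin n)
    {H : Polynomial (Polynomial ℂ)}
    (hH : (Polynomial.eval₂RingHom (Polynomial.eval₂RingHom
        (algebraMap ℂ (MvPolynomial (Fin n ⊕ Fin n) ℂ ⧸ vanishingIdeal ℂ (p '' M)))
        (Ideal.Quotient.mk _ (X i))) (Ideal.Quotient.mk _ (X j))) H = 0)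
    {m : ℕ} (hm : m ∈ M) :
    (H.map (Polynomial.evalRingHom (p m i))).eval (p m j) = 0 := by
  set J := vanishingIdeal ℂ (p '' M) with hJ
  have hkill : ∀ a ∈ J, aeval (p m) a = 0 := fun a ha => (mem_vanishingIdeal_iff.1 ha) _ ⟨m, hm, rfl⟩
  let ψ : (MvPolynomial (Fin n ⊕ Fin n) ℂ ⧸ J) →ₐ[ℂ] ℂ := Ideal.Quotient.liftₐ J (aeval (p m)) hkill
  have hψX : ∀ k, ψ (Ideal.Quotient.mk J (X k)) = p m k := fun k => by
    change Ideal.Quotient.liftₐ J (aeval (p m)) hkill (Ideal.Quotient.mk J (X k)) = p m k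
    rw [Ideal.Quotient.liftₐ_apply, Ideal.Quotient.lift_mk, RingHom.coe_coe, MvPolynomial.aeval_X]
  have h := congrArg ψ hH
  rw [map_zero, Polynomial.coe_eval₂RingHom, ← AlgHom.coe_toRingHom, Polynomial.hom_eval₂,
    AlgHom.coe_toRingHom, hψX] at h
  have hcomp : (ψ : _ →+* ℂ).comp (Polynomial.eval₂RingHom (algebraMap ℂ _)
      (Ideal.Quotient.mk J (X i))) = Polynomial.evalRingHom (p m i) := by
    refine Polynomial.ringHom_ext (fun a => ?_) ?_
    · rw [RingHom.comp_apply, Polynomial.coe_eval₂RingHom, Polynomial.eval₂_C, RingHom.coe_coe,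
        AlgHom.commutes, Polynomial.coe_evalRingHom, Polynomial.eval_C, Algebra.algebraMap_self,
        RingHom.id_apply]
    · rw [RingHom.comp_apply, Polynomial.coe_eval₂RingHom, Polynomial.eval₂_X, RingHom.coe_coe, hψX,
        Polynomial.coe_evalRingHom, Polynomial.eval_X]
  rw [hcomp, ← Polynomial.eval_map] at h
  exact h

/-! ## Part B. The identity principle at `u = 0` for `u ↦ H(1/u, w(u))` -/

/-- `u^N · r(1/u)` as a polynomial function of `u` (for `deg r ≤ N`). [folklore] -/
theorem pow_mul_eval_inv_eq_sum (r : ℂ[X]) {N : ℕ} (hN : r.natDegree ≤ N) {u : ℂ} (hu : u ≠ 0) :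
    u ^ N * r.eval u⁻¹ = ∑ i ∈ Finset.range (N + 1), r.coeff i * u ^ (N - i) := by
  rw [Polynomial.eval_eq_sum_range' (Nat.lt_succ_of_le hN), Finset.mul_sum]
  refine Finset.sum_congr rfl fun i hi => ?_
  have hi' : i ≤ N := Nat.lt_succ_iff.1 (Finset.mem_range.1 hi)
  rw [inv_pow, pow_sub₀ _ hu hi']
  ring

/-- **Identity principle.**  If `w` is analytic at `0`, `H ∈ ℂ[s][t]`, and `H(z_k, w(1/z_k)) = 0` along
a sequence with `‖z_k‖ → ∞`, then `H(1/u, w(u)) = 0` for all small `u ≠ 0`. [folklore] -/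
theorem eventually_evalPP_inv_eq_zero {w : ℂ → ℂ} (hw : AnalyticAt ℂ w 0) (H : ℂ[X][X]) {z : ℕ → ℂ}
    (hz : Tendsto (fun k => ‖z k‖) atTop atTop)
    (hH : ∀ k, (H.map (Polynomial.evalRingHom (z k))).eval (w (z k)⁻¹) = 0) :
    ∀ᶠ u in 𝓝[≠] (0 : ℂ), (H.map (Polynomial.evalRingHom u⁻¹)).eval (w u) = 0 := by
  classical
  -- a common bound for the `s`-degrees of the coefficients
  set N : ℕ := (Finset.range (H.natDegree + 1)).sup fun j => (H.coeff j).natDegree with hN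
  have hNj : ∀ j ∈ Finset.range (H.natDegree + 1), (H.coeff j).natDegree ≤ N := fun j hj =>
    Finset.le_sup (f := fun j => (H.coeff j).natDegree) hj
  -- the analytic function `h(u) = u^N H(1/u, w u)`
  set h : ℂ → ℂ := fun u => ∑ j ∈ Finset.range (H.natDegree + 1),
    (∑ i ∈ Finset.range (N + 1), (H.coeff j).coeff i * u ^ (N - i)) * w u ^ j with hh
  have hhan : AnalyticAt ℂ h 0 := by
    refine Finset.analyticAt_fun_sum _ fun j _ => AnalyticAt.mul ?_ (hw.pow j)
    exact Finset.analyticAt_fun_sum _ fun i _ => analyticAt_const.mul (analyticAt_id.pow _)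
  have hh_eq : ∀ u : ℂ, u ≠ 0 →
      h u = u ^ N * (H.map (Polynomial.evalRingHom u⁻¹)).eval (w u) := by
    intro u hu
    rw [hh, evalPP_eq_sum H u⁻¹ (w u) (Nat.lt_succ_self _), Finset.mul_sum]
    refine Finset.sum_congr rfl fun j hj => ?_
    rw [← pow_mul_eval_inv_eq_sum _ (hNj j hj) hu]
    ring
  -- zeros of `h` accumulating at `0`
  have hu : Tendsto (fun k => (z k)⁻¹) atTop (𝓝[≠] (0 : ℂ)) :=
    tendsto_inv₀_cobounded'.comp (tendsto_norm_atTop_iff_cobounded.1 hz)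
  have hz0 : ∀ᶠ k in atTop, z k ≠ 0 := by
    filter_upwards [hz.eventually_gt_atTop 0] with k hk
    exact norm_pos_iff.1 hk
  have hzero : ∀ᶠ k in atTop, h (z k)⁻¹ = 0 := by
    filter_upwards [hz0] with k hk
    rw [hh_eq _ (inv_ne_zero hk), inv_inv, hH k, mul_zero]
  rcases hhan.eventually_eq_zero_or_eventually_ne_zero with h0 | hne
  · have h0' : ∀ᶠ u in 𝓝[≠] (0 : ℂ), h u = 0 ∧ u ≠ 0 :=
      (h0.filter_mono nhdsWithin_le_nhds).and self_mem_nhdsWithin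
    filter_upwards [h0'] with u hu'
    have h1 := hu'.1
    rw [hh_eq u hu'.2] at h1
    exact (mul_eq_zero.1 h1).resolve_left (pow_ne_zero _ hu'.2)
  · exfalso
    obtain ⟨k, hk1, hk2⟩ := ((hu.eventually hne).and hzero).exists
    exact hk1 hk2

/-! ## Part C. THEOREM T -/

/-- **THEOREM T (generic sequences from a transcendental exact relation).**  On an irreducible
closed `S` of dimension `≤ 2`, let `p_m ∈ S` with `‖x_{j₀}(p_m)‖ → ∞` and
`(p_m)_{y_{j₁}} = w(1/x_{j₀}(p_m))`, where `w` is analytic at `0` and no nonzero `H ∈ ℂ[s][t]` has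
`H(1/u, w u) = 0` for all small `u ≠ 0`.  Then every `f ∉ I(S)` vanishes at only finitely many `p_m`.
[folklore] (new) -/
theorem finite_zeros_of_transcendental_relation {S : Set (Fin n ⊕ Fin n → ℂ)}
    (hS : IsIrreducibleClosed ℂ S) (hdim : zariskiDim ℂ S ≤ (2 : ℕ)) (j₀ j₁ : Fin n)
    {p : ℕ → Fin n ⊕ Fin n → ℂ} (hpS : ∀ m, p m ∈ S)
    (hnorm : Tendsto (fun m => ‖p m (Sum.inl j₀)‖) atTop atTop)
    {w : ℂ → ℂ} (hw : AnalyticAt ℂ w 0) (hrel : ∀ m, p m (Sum.inr j₁) = w (p m (Sum.inl j₀))⁻¹)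
    (htr : ∀ H : ℂ[X][X], H ≠ 0 →
      ¬ (∀ᶠ u in 𝓝[≠] (0 : ℂ), (H.map (Polynomial.evalRingHom u⁻¹)).eval (w u) = 0))
    (f : MvPolynomial (Fin n ⊕ Fin n) ℂ) (hf : f ∉ vanishingIdeal ℂ S) :
    Set.Finite {m | aeval (p m) f = 0} := by
  classical
  by_contra hinf
  change Set.Infinite {m | aeval (p m) f = 0} at hinf
  set x : ℕ → ℂ := fun m => p m (Sum.inl j₀) with hxdef
  -- a prime vanishing ideal of an infinite subsequence of zeros of `f`
  obtain ⟨M, hMinf, hMf, hJ⟩ := exists_infinite_isPrime_vanishingIdeal hinf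
  set J := vanishingIdeal ℂ (p '' M) with hJdef
  haveI := hJ
  have hIJ : vanishingIdeal ℂ S ≤ J :=
    vanishingIdeal_anti_mono (by rintro _ ⟨m, -, rfl⟩; exact hpS m)
  have hfJ : f ∈ J := by
    rw [hJdef, mem_vanishingIdeal_iff]
    rintro _ ⟨m, hm, rfl⟩
    exact hMf m hm
  have hdimJ := ringKrullDim_quotient_le_one hS hdim hIJ hfJ hf
  set Q' := MvPolynomial (Fin n ⊕ Fin n) ℂ ⧸ J with hQ'
  haveI : IsDomain Q' := Ideal.Quotient.isDomain _
  have htr1 : Algebra.trdeg ℂ Q' ≤ 1 := by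
    have h := Literature.RingTheory.KrullDimension.ringKrullDim_eq_trdeg ℂ Q'
    rw [h] at hdimJ
    have hnat : Cardinal.toNat (Algebra.trdeg ℂ Q') ≤ 1 := by exact_mod_cast hdimJ
    rw [Literature.RingTheory.KrullDimension.trdeg_eq_toNat ℂ Q']
    exact_mod_cast hnat
  -- `x_{j₀}` transcendental, `y_{j₁}` algebraic over `ℂ[x_{j₀}]` modulo `J`
  have hxM : ∀ R : ℝ, ∃ m ∈ M, R ≤ ‖x m‖ := by
    intro R
    rcases (tendsto_atTop_atTop.1 hnorm R) with ⟨N', hN'⟩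
    obtain ⟨m, hm, hNm⟩ := hMinf.exists_gt N'
    exact ⟨m, hm, hN' m hNm.le⟩
  haveI : FaithfulSMul ℂ Q' := (faithfulSMul_iff_algebraMap_injective ℂ Q').2 (algebraMap ℂ Q').injective
  have hutr := transcendental_mk_X_of_unbounded (p := p) (M := M) j₀ hxM
  obtain ⟨H, hH0, hHuv⟩ := exists_polyPoly_relation
    (isAlgebraic_adjoin_of_trdeg_le_one htr1 hutr (Ideal.Quotient.mk J (X (Sum.inr j₁))))
  have hHroot : ∀ m ∈ M, (H.map (Polynomial.evalRingHom (x m))).eval (w (x m)⁻¹) = 0 := by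
    intro m hm
    rw [hxdef, ← hrel m]
    exact polyPoly_eval_eq_zero_of_mem₂ (Sum.inl j₀) (Sum.inr j₁) hHuv hm
  -- pass to the subsequence indexed by `M` and apply the identity principle
  set φ : ℕ → ℕ := Nat.nth (· ∈ M) with hφ
  have hφM : ∀ k, φ k ∈ M := fun k => Nat.nth_mem_of_infinite (p := (· ∈ M)) hMinf k
  have hφtop : Tendsto φ atTop atTop := (Nat.nth_strictMono (p := (· ∈ M)) hMinf).tendsto_atTop
  have hztop : Tendsto (fun k => ‖x (φ k)‖) atTop atTop := hnorm.comp hφtop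
  exact htr H hH0 (eventually_evalPP_inv_eq_zero hw H hztop fun k => hHroot _ (hφM k))

/-- **THEOREM T (density from an exact transcendental relation).**  If the sequence of THEOREM T
consists of exponential points of `S`, then `S` has Zariski-dense exponential points
(`UnprojectedDense S`). [folklore] (new) -/
theorem unprojectedDense_of_transcendental_relation {S : Set (Fin n ⊕ Fin n → ℂ)}
    (hS : IsIrreducibleClosed ℂ S) (hdim : zariskiDim ℂ S ≤ (2 : ℕ)) (j₀ j₁ : Fin n)
    {p : ℕ → Fin n ⊕ Fin n → ℂ} (hpS : ∀ m, p m ∈ S) (hpΓ : ∀ m, p m ∈ expGraph ℂ n)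
    (hnorm : Tendsto (fun m => ‖p m (Sum.inl j₀)‖) atTop atTop)
    {w : ℂ → ℂ} (hw : AnalyticAt ℂ w 0) (hrel : ∀ m, p m (Sum.inr j₁) = w (p m (Sum.inl j₀))⁻¹)
    (htr : ∀ H : ℂ[X][X], H ≠ 0 →
      ¬ (∀ᶠ u in 𝓝[≠] (0 : ℂ), (H.map (Polynomial.evalRingHom u⁻¹)).eval (w u) = 0)) :
    UnprojectedDense S := by
  refine le_antisymm ?_ (vanishingIdeal_anti_mono Set.inter_subset_left)
  intro f hf
  by_contra hfS
  have hfin := finite_zeros_of_transcendental_relation hS hdim j₀ j₁ hpS hnorm hw hrel htr f hfS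
  have hall : {m | aeval (p m) f = 0} = Set.univ := by
    ext m
    simp only [Set.mem_setOf_eq, Set.mem_univ, iff_true]
    exact (mem_vanishingIdeal_iff.1 hf) _ ⟨hpS m, hpΓ m⟩
  rw [hall] at hfin
  exact Set.infinite_univ hfin

end Summit.Schanuel.Schanuel.Theorems
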